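import Literature.Algebra.Lie.LefschetzModuleKleimanAlgebraMatrix
import Literature.Algebra.Lie.LefschetzModuleSelfAdjoint
import HarnessLib

/-!
# Under André's isomorphism `K[L, ᶜΛ] ≅ ⊕ M_{k+1}(K)`, transposition for `(x, y) ↦ ∫ x ∪ * y` is matrix transposition
# (André 1996, Prop. 1.2, last clause)

Topic `Literature/Algebra/Lie` (namespace `Literature.Algebra.Lie`).  Lane `lit-hodgefound` (Track 2 foundations library),
prover seat `lit-hodgefound-p34` (generation 30, row g30-#6), the junction of row g30-#5 (`LefschetzModuleKleimanAlgebraMatrix.lean`: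
the matrix units `E⁽ᵏ⁾_{ab} = stringUnit k a b`, André's `Φ = matrixHom : (Π_{k ∈ stringTypes} M_{k+1}(K)) →ₐ End M` with range
`K[e, ᶜΛ]`) and row g30-#3 (`LefschetzModuleSelfAdjoint.lean`: for a Poincaré-type pairing `B` — `h` skew-adjoint, `e` self-adjoint —
strings of different lengths or non-complementary positions are `B`-orthogonal).  PROVED theorems only (no definition, no named fact,
no `sorry`, no instance, no notation; net debt `0`).

## Source, VERBATIM

Y. André, *Pour une théorie inconditionnelle des motifs*, Publ. Math. IHÉS **83** (1996) [Andre1996Motifs] (held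
`paper:doi-10-1007-bf02698643`), Prop. 1.2 (p. 11 = p0008 L64–L66): "Via cet isomorphisme, la transposition relative à la forme
bilinéaire `(x, y) ↦ ∫ x ∪ * y` correspond à la transposition des matrices, pour `* = *_L` ou `*_H`."; proof (p. 12 = p0009 L13–L15):
"Quant à la dernière assertion, il suffit de la tester sur les générateurs `L` et `*_L L *_L`. Comme ces générateurs s'échangent par la
transposition, c'est clair."

## Rendering

* "la forme bilinéaire `(x, y) ↦ ∫ x ∪ * y`": the twisted form `B⋆ = B.compl₂ s`, `B⋆ x y = B x (s y)`, of a bilinear form `B` on the graded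
  `(M, h)` with `B.IsSkewAdjoint h` (Poincaré duality pairs complementary degrees) and `B.IsSelfAdjoint e` (`∫ Lx ∪ y = ∫ x ∪ Ly`),
  twisted by `s = *_L = L.lefschetzInvolution hgr` or `s = *_H = L.hodgeInvolution hgr d` (rows g29-#2/#3).
* "la transposition […] correspond à la transposition des matrices": for every family of matrices `c = (c_k)_k`, the operators `Φ(c)` and
  `Φ(cᵀ)` (`cᵀ = (c_kᵀ)_k`) are mutually adjoint for `B⋆` — `LinearMap.IsAdjointPair B⋆ B⋆ (Φ c) (Φ cᵀ)`.  André's generators: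
  `Φ(subdiag) = e` and `Φ(superdiag) = Φ(subdiagᵀ) = *_L e *_L` (g30-#5 `matrixHom_subdiag` / `matrixHom_superdiag`) "s'échangent par la
  transposition" (g30-#3 `isAdjointPair_compl₂_lefschetzInvolution`); here the statement is proved for ALL `c` at once, on the strings.

## Contents (all proved; `L : HasLefschetzProperty h e`, `hgr`, `hh : B.IsSkewAdjoint h`, `he : B.IsSelfAdjoint e`)

* `apply_pow_primitive_sum_smul_pow_primitive` / `sum_smul_apply_pow_primitive_pow_primitive` (the pairing of a string vector with a
  combination of reversed string vectors keeps one term), **`matrixHom_transpose_isAdjointPair_of_apply_pow_primitive`** (for any operator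
  `s` acting on strings by `s (eʲ p) = σ_k e^{k-j} p`: `Φ(c)` and `Φ(cᵀ)` are `B.compl₂ s`-adjoint),
  **`matrixHom_transpose_isAdjointPair_lefschetzInvolution`** (`* = *_L`), **`matrixHom_transpose_isAdjointPair_hodgeInvolution`**
  (`* = *_H`), `isSelfAdjoint_matrixHom_of_isSymm_lefschetzInvolution` / `…_hodgeInvolution` (symmetric families give
  `B⋆`-self-adjoint operators).

## References

* [Andre1996Motifs] Y. André, *Pour une théorie inconditionnelle des motifs*, Publ. Math. IHÉS 83 (1996) 5–49, Prop. 1.2 and its proof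
  (pp. 11–12).
* [Kleiman1968AlgebraicCycles] S. L. Kleiman, *Algebraic cycles and the Weil conjectures* (1968), §1.4 (1.4.2–1.4.5) — via André.
-/

noncomputable section

namespace Literature.Algebra.Lie

open Module Function Set
open LinearMap (BilinForm)
open HasLefschetzProperty (primitiveSpace mem_primitiveSpace_iff)

variable {K : Type*} [Field K] [CharZero K] {M : Type*} [AddCommGroup M] [Module K M] [FiniteDimensional K M]
  {B : BilinForm K M} {h e : Module.End K M}

namespace HasLefschetzProperty

omit [FiniteDimensional K M] in
/-- **One term survives**: for `p, p' ∈ P_{-k}`, `j, j' ≤ k` and scalars `γ_a`,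
`B(Σ_a γ_a eᵃ p, e^{k-j'} p') = γ_{j'} B(eᵏ p, p')` (only the complementary position pairs non-trivially).
[cite: Andre1996Motifs, Prop. 1.2 (p. 12, proof)] -/
theorem sum_smul_apply_pow_primitive_pow_primitive (L : HasLefschetzProperty h e) (hh : B.IsSkewAdjoint h) (he : B.IsSelfAdjoint e)
    {k : ℕ} {p p' : M} (hp : p ∈ primitiveSpace h e k) (hp' : p' ∈ primitiveSpace h e k) (γ : Fin (k + 1) → K)
    {j' : ℕ} (hj' : j' ≤ k) :
    B (∑ a : Fin (k + 1), γ a • (e ^ (a : ℕ)) p) ((e ^ (k - j')) p') = γ ⟨j', Nat.lt_succ_of_le hj'⟩ * B ((e ^ k) p) p' := by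
  rw [map_sum, LinearMap.sum_apply,
    Finset.sum_eq_single_of_mem (⟨j', Nat.lt_succ_of_le hj'⟩ : Fin (k + 1)) (Finset.mem_univ _) fun a _ ha ↦ ?_]
  · rw [map_smul, LinearMap.smul_apply, smul_eq_mul, apply_pow_primitive_pow_primitive_eq he (show j' + (k - j') = k by omega)]
  · rw [map_smul, LinearMap.smul_apply, smul_eq_mul,
      apply_pow_primitive_pow_primitive_eq_zero L hh he hp hp' fun h' ↦ ha (Fin.ext ?_), mul_zero]
    have h1 : (a : ℕ) + (k - j') = k := h'.2
    show (a : ℕ) = j'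
    omega

omit [FiniteDimensional K M] in
/-- **One term survives**, the transposed situation: `B(eʲ p, Σ_a γ_a e^{k-a} p') = γ_j B(eᵏ p, p')`.
[cite: Andre1996Motifs, Prop. 1.2 (p. 12, proof)] -/
theorem apply_pow_primitive_sum_smul_pow_primitive (L : HasLefschetzProperty h e) (hh : B.IsSkewAdjoint h) (he : B.IsSelfAdjoint e)
    {k : ℕ} {p p' : M} (hp : p ∈ primitiveSpace h e k) (hp' : p' ∈ primitiveSpace h e k) (γ : Fin (k + 1) → K)
    {j : ℕ} (hj : j ≤ k) :
    B ((e ^ j) p) (∑ a : Fin (k + 1), γ a • (e ^ (k - (a : ℕ))) p') = γ ⟨j, Nat.lt_succ_of_le hj⟩ * B ((e ^ k) p) p' := by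
  rw [map_sum, Finset.sum_eq_single_of_mem (⟨j, Nat.lt_succ_of_le hj⟩ : Fin (k + 1)) (Finset.mem_univ _) fun a _ ha ↦ ?_]
  · rw [map_smul, smul_eq_mul, apply_pow_primitive_pow_primitive_eq he (show j + (k - j) = k by omega)]
  · rw [map_smul, smul_eq_mul, apply_pow_primitive_pow_primitive_eq_zero L hh he hp hp' fun h' ↦ ha (Fin.ext ?_), mul_zero]
    have h1 : j + (k - (a : ℕ)) = k := h'.2
    have h2 : (a : ℕ) < k + 1 := a.2
    show (a : ℕ) = j
    omega

/-- **Prop. 1.2, last clause, for every operator `s` reversing the strings up to scalars** (`s (eʲ p) = σ_k · e^{k-j} p` for `p ∈ P_{-k}`):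
for the twisted form `B⋆(x, y) = B(x, s y)`, the operators `Φ(c)` and `Φ(cᵀ)` are mutually adjoint —
`B(Φ(c) x, s y) = B(x, s (Φ(cᵀ) y))`.  On strings `x = eʲ p`, `y = eʲ' p'` of lengths `k + 1`, `k' + 1` both sides vanish unless `k = k'`,
and then both equal `σ_k c_k[j'][j] B(eᵏ p, p')`. [cite: Andre1996Motifs, Prop. 1.2 (pp. 11–12)] -/
theorem matrixHom_transpose_isAdjointPair_of_apply_pow_primitive (L : HasLefschetzProperty h e) (hgr : IsZGrading h)
    (hh : B.IsSkewAdjoint h) (he : B.IsSelfAdjoint e) {s : Module.End K M} {σ : ℕ → K}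
    (hs : ∀ ⦃k : ℕ⦄ ⦃p : M⦄, p ∈ primitiveSpace h e k → ∀ ⦃j : ℕ⦄, j ≤ k → s ((e ^ j) p) = σ k • (e ^ (k - j)) p)
    (c : (k : stringTypes h e) → Matrix (Fin ((k : ℕ) + 1)) (Fin ((k : ℕ) + 1)) K) :
    LinearMap.IsAdjointPair (B.compl₂ s) (B.compl₂ s) ⇑(L.matrixHom hgr c) ⇑(L.matrixHom hgr fun k ↦ (c k).transpose) := by
  refine isAdjointPair_of_strings L hgr fun k p hp j hj k' p' hp' j' hj' ↦ ?_
  rw [LinearMap.compl₂_apply, LinearMap.compl₂_apply, matrixHom_apply, matrixHom_apply]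
  by_cases hk : k ∈ stringTypes h e
  swap
  · rw [L.eq_zero_of_not_mem_stringTypes hk hp]
    simp only [map_zero, LinearMap.zero_apply]
  by_cases hk' : k' ∈ stringTypes h e
  swap
  · rw [L.eq_zero_of_not_mem_stringTypes hk' hp']
    simp only [map_zero]
  have hsa : ∀ a : Fin (k' + 1), s ((e ^ (a : ℕ)) p') = σ k' • (e ^ (k' - (a : ℕ))) p' :=
    fun a ↦ hs hp' (Nat.le_of_lt_succ a.2)
  have hT : L.matrixLinearMap hgr (fun k ↦ (c k).transpose) ((e ^ j') p') =
      ∑ a : Fin (k' + 1), c ⟨k', hk'⟩ ⟨j', Nat.lt_succ_of_le hj'⟩ a • (e ^ (a : ℕ)) p' := by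
    rw [L.matrixLinearMap_apply_pow_primitive hgr _ hk' hp' hj']
    rfl
  rw [L.matrixLinearMap_apply_pow_primitive hgr c hk hp hj, hT, hs hp' hj', map_smul, map_sum s]
  simp only [map_smul, hsa, smul_smul]
  by_cases hkk : k = k'
  · subst hkk
    rw [L.sum_smul_apply_pow_primitive_pow_primitive hh he hp hp' _ hj',
      L.apply_pow_primitive_sum_smul_pow_primitive hh he hp hp' _ hj, smul_eq_mul]
    ring
  · -- different lengths: everything is orthogonal
    have h0 : ∀ a b : ℕ, B ((e ^ a) p) ((e ^ b) p') = 0 := fun a b ↦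
      apply_pow_primitive_pow_primitive_eq_zero L hh he hp hp' fun h' ↦ hkk h'.1
    simp only [map_sum, map_smul, LinearMap.sum_apply, LinearMap.smul_apply, h0, smul_zero, Finset.sum_const_zero]

/-- **ANDRÉ, PROP. 1.2, LAST CLAUSE for `* = *_L`**: for the form `(x, y) ↦ B(x, *_L y)`, `Φ(c)` and `Φ(cᵀ)` are mutually adjoint —
under the isomorphism `K[L, ᶜΛ] ≅ ⊕ M_{k+1}(K)` the transposition relative to `∫ x ∪ *_L y` is matrix transposition.
[cite: Andre1996Motifs, Prop. 1.2 (pp. 11–12)] -/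
theorem matrixHom_transpose_isAdjointPair_lefschetzInvolution (L : HasLefschetzProperty h e) (hgr : IsZGrading h)
    (hh : B.IsSkewAdjoint h) (he : B.IsSelfAdjoint e)
    (c : (k : stringTypes h e) → Matrix (Fin ((k : ℕ) + 1)) (Fin ((k : ℕ) + 1)) K) :
    LinearMap.IsAdjointPair (B.compl₂ (L.lefschetzInvolution hgr)) (B.compl₂ (L.lefschetzInvolution hgr))
      ⇑(L.matrixHom hgr c) ⇑(L.matrixHom hgr fun k ↦ (c k).transpose) :=
  L.matrixHom_transpose_isAdjointPair_of_apply_pow_primitive hgr hh he (σ := fun _ ↦ 1)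
    (fun _ _ hp _ hj ↦ by rw [L.isStringReversal_lefschetzInvolution hgr hp hj, one_smul]) c

/-- **ANDRÉ, PROP. 1.2, LAST CLAUSE for `* = *_H`**: for the form `(x, y) ↦ B(x, *_H y)`, `Φ(c)` and `Φ(cᵀ)` are mutually adjoint.
[cite: Andre1996Motifs, Prop. 1.2 (pp. 11–12, "pour * = *_L ou *_H")] -/
theorem matrixHom_transpose_isAdjointPair_hodgeInvolution (L : HasLefschetzProperty h e) (hgr : IsZGrading h) (d : ℕ)
    (hh : B.IsSkewAdjoint h) (he : B.IsSelfAdjoint e)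
    (c : (k : stringTypes h e) → Matrix (Fin ((k : ℕ) + 1)) (Fin ((k : ℕ) + 1)) K) :
    LinearMap.IsAdjointPair (B.compl₂ (L.hodgeInvolution hgr d)) (B.compl₂ (L.hodgeInvolution hgr d))
      ⇑(L.matrixHom hgr c) ⇑(L.matrixHom hgr fun k ↦ (c k).transpose) :=
  L.matrixHom_transpose_isAdjointPair_of_apply_pow_primitive hgr hh he
    (σ := fun k ↦ (-1 : K) ^ ((d - k) * (d - k + 1) / 2)) (fun _ _ hp _ hj ↦ L.hodgeInvolution_apply_pow_primitive hgr d hp hj) c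

/-- A family of SYMMETRIC matrices gives a `B(·, *_L ·)`-self-adjoint element of `K[L, ᶜΛ]`. [cite: Andre1996Motifs, Prop. 1.2 (pp. 11–12)] -/
theorem isSelfAdjoint_matrixHom_of_isSymm_lefschetzInvolution (L : HasLefschetzProperty h e) (hgr : IsZGrading h)
    (hh : B.IsSkewAdjoint h) (he : B.IsSelfAdjoint e)
    {c : (k : stringTypes h e) → Matrix (Fin ((k : ℕ) + 1)) (Fin ((k : ℕ) + 1)) K} (hc : ∀ k, (c k).IsSymm) :
    (B.compl₂ (L.lefschetzInvolution hgr)).IsSelfAdjoint ⇑(L.matrixHom hgr c) := by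
  have h1 := L.matrixHom_transpose_isAdjointPair_lefschetzInvolution hgr hh he c
  have h2 : (fun k ↦ (c k).transpose) = c := funext fun k ↦ hc k
  rw [h2] at h1
  exact h1

/-- A family of symmetric matrices gives a `B(·, *_H ·)`-self-adjoint element of `K[L, ᶜΛ]`. [cite: Andre1996Motifs, Prop. 1.2 (pp. 11–12)] -/
theorem isSelfAdjoint_matrixHom_of_isSymm_hodgeInvolution (L : HasLefschetzProperty h e) (hgr : IsZGrading h) (d : ℕ)
    (hh : B.IsSkewAdjoint h) (he : B.IsSelfAdjoint e)
    {c : (k : stringTypes h e) → Matrix (Fin ((k : ℕ) + 1)) (Fin ((k : ℕ) + 1)) K} (hc : ∀ k, (c k).IsSymm) :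
    (B.compl₂ (L.hodgeInvolution hgr d)).IsSelfAdjoint ⇑(L.matrixHom hgr c) := by
  have h1 := L.matrixHom_transpose_isAdjointPair_hodgeInvolution hgr d hh he c
  have h2 : (fun k ↦ (c k).transpose) = c := funext fun k ↦ hc k
  rw [h2] at h1
  exact h1

end HasLefschetzProperty

end Literature.Algebra.Lie

end
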